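import Summits.BirchSwinnertonDyer.BirchSwinnertonDyer.Theorems.KatoDescentPotSupersingularUnitIndexMuDoorsFukudaAt
import Summits.BirchSwinnertonDyer.BirchSwinnertonDyer.Theorems.KatoDescentPotSupersingularWildUpperUnitTwistRecordsClassO606
import Summits.BirchSwinnertonDyer.BirchSwinnertonDyer.Theorems.KatoDescentPotSupersingularWildUpperUnitTwistRecordsClassO617
import Summits.BirchSwinnertonDyer.BirchSwinnertonDyer.Theorems.KatoDescentPotSupersingularWildUpperUnitTwistRecordsClassO618
import Summits.BirchSwinnertonDyer.BirchSwinnertonDyer.Theorems.KatoDescentPotSupersingularWildUpperUnitTwistRecordsClassO621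
import Summits.BirchSwinnertonDyer.BirchSwinnertonDyer.Theorems.KatoDescentPotSupersingularWildUpperUnitTwistRecordsClassO624
import HarnessLib

/-!
# Route `KatoDescentPotSupersingular` (rung K9, sub-rung B5 = O6 wild `p = 3`, cell `bsd-potss`): per-row U₀ RECORDS on the `GL₂(𝔽₃)`-image (9-deficient) U₀-ns rows WHOSE
# UNIPOTENT-STABILISER FIELD `L_P = ℚ(E[3])^{U_P} = ℚ(P, ζ₃)` GROWS at layer `(0,1)` — Fukuda Thm. 1 (1) at layers `(1,2)` on `L_P`, the layer equality decided WITHOUT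
# the degree-48/144 layers: door UG at `(1,2)` on the growing octic leaf `O_grow` (degree-24 data, THIS seat's kit j316285) + Kuroda's `V₄` relation + Fukuda `(0,1)` on the
# non-growing leaves (conjA-anchor g9 kit j296187); rows: 7776f1, 194400cn1, 388800hd1, 388800ij1, 470448dq1
# (seat `bsd-potss-k9-c4` g23; door = k9-c4 g19's `UnitIndexMuDoors.missingUpperBoundAt_three_of_classNumberPExp_succ_eqAt_unipotentStabilizerField` (p635084) at `n = 1`;
# record shape = k9-c4 g21's `…WildConjAResidueUnitIndexRows06` (388800ho1) verbatim; `--supports stmt-BirchSwinnertonDyer-19197 --as helper`)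

HONEST FRAMING. THEOREMS ONLY (no definition, no named fact, no `sorry`); PER ROW — NOT a class theorem; nothing booked; items 19189 / 19197 (and the aside 19386) stay OPEN at
class level (open non-held input of the U₀ cone: the zeta crux 24327); (A), Conjecture A and BSD are proved for NO curve here.  CONDITIONAL on the named facts displayed as
hypotheses (Lim 2017 Thm. 3.5 `hLim`, Fukuda 1994 Thm. 1 (1) `hF1`; for U₀ also Kato's A161-fine `hKatoA`, GZK `hGZK`, modularity `hmod`) and on two displayed NUMERIC
hypotheses about `L_P = ℚ(E[3])^{U_P}` (`P` any `3`-torsion point; conjA-anchor g9: the image of `U_P` is a `3`-group, so Lim's index hypothesis is structural):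
* `hram` — Fukuda's index is `0` on `L_P` (EXACT, kit j296187: the ramification indices of the primes of `k = ℚ(x(P))` above `3` triple in `k₁`, and `[L_P : k] = 4`);
* `hord` — `e₂(L_P) = e₁(L_P)`.  EVIDENCE (two tree theorems applied to PARI data; not kernel-derived here): `L_P/k` is biquadratic with octic intermediate fields
  `O₁ = ℚ(P)`, `O₂`, `O₃`, so Kuroda's relation up the cyclotomic tower (tree theorem `IwasawaTheory.classNumberPExp_biquadratic_relation`, conjA-anchor g11; exact on
  `3`-parts) reads `e_n(L_P) + 2·e_n(k) = e_n(O₁) + e_n(O₂) + e_n(O₃)` for every `n`; on each row `k` and the two NON-growing leaves have `3 ∤ h` at layers 0 AND 1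
  (kit j296187: layer 0 CERTIFIED, layer 1 GRH), hence `e_n = 0` for all `n` there (Fukuda Thm. 1 (1), `n₀ = 0`), so `e_n(L_P) = e_n(O_grow)` for all `n`; and `O_grow`
  (`e₀ = 0 < e₁`) PASSES the `e_n`-tolerant unit-norm-index door UG at layers `(1,2)` (THIS seat's kit j316285, engine = conjA-anchor g14's `ug12.gp`: on `F = O_grow,1`
  (degree 24, `bnfinit` GRH, `bnfcertify` attempted) every prime above `3` ramifies in `F₂ = F·ℚ(ζ₂₇)⁺`, the unit norm symbols have rank `s − 1`, and the classes of the
  primes above `3` generate `Cl(F)` modulo cubes), hence `e₂(O_grow) = e₁(O_grow)` by the KERNEL theorem `IwasawaTheory.classNumberPExp_succ_eq_of_sup_eq_top`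
  (conjA-anchor g14, p644996).  Therefore `e₂(L_P) = e₁(L_P)`; GRH enters only through the degree-24 class groups.  (For 388800ij1 the field `L_P` and its leaves
  coincide with 388800ho1's — k9-c4 g21 `…Rows06`, conjA-anchor g14 §5 — and the UG numerics below RE-RUN conjA's j311095 on the same `O_grow`.)
Then Fukuda 1994 Thm. 1 (1) gives `e_n(L_P) = e₁(L_P)` for all `n ≥ 1`, i.e. `μ(L_P,cyc) = 0`, Lim 2017 Thm. 3.5 + Lemma 3.2 give Conjecture A at `3`, and Kato 14.5 (3) /
12.5 (3) (A161-fine) + GZK + modularity give U₀.  KERNEL row certificates (imported): `Δ ≠ 0`, global minimality, `irr_g…_3`, `classO6_g…_3`.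

References: [Lim2017FineSelmer] §3 Thm. 3.5, Lemma 3.2; [Fukuda1994] Thm. 1 (1); [Lang1990] Ch. 13 §4 Lemma 4.1; [Lemmermeyer1994] §1 (Kuroda); [Kato2004Asterisque] Thm. 14.5 (3);
[CoatesSujatha2005] Thm. 3.4; [Serre1972] §IV; [Cremona2006] Table 1.
-/

set_option linter.dupNamespace false
set_option autoImplicit false

noncomputable section

open scoped Classical NumberField
open WeierstrassCurve NumberField IsDedekindDomain Field IntermediateField
  Literature.NumberTheory.EllipticCurves Literature.NumberTheory.EllipticCurves.Rank1Residual
  Literature.NumberTheory.EllipticCurves.Rank1Residual.Typed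
  Literature.NumberTheory.GaloisRepresentations Literature.NumberTheory.SerreUniformity Literature.NumberTheory.IwasawaTheory
  Summit.BirchSwinnertonDyer.Rank1Residual Summit.BirchSwinnertonDyer.Rank1Residual.Additive
  Summit.BirchSwinnertonDyer.BirchSwinnertonDyer.Theorems

namespace Summit.BirchSwinnertonDyer.BirchSwinnertonDyer.Theorems.WildUpperUnitTwistRecords

/-! ### `7776f1` @ `p = 3` — `N = 7776 = 2^5·3^5`; Cremona: `r_an = 0`; O6 wild at `3`; mod-`3` image `GL₂(𝔽₃)` (9-deficient tower; NO Cartan road); first road: the unit-twist record `missingUpperBoundAt_g7776f1_3` (k9-c4 g16/g17);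
kernel lemmas in `…WildUpperUnitTwistRecordsClassO624` (`classO6`) / `…WildUpperUnitTwistRecordsFlat50` (`irr`, `isElliptic`, `isGloballyMinimal`).  conjA-anchor g9 kit j296187 (`lp16.gp`): `k = ℚ(x(P)) = ℚ[x]/(x^4-2*x^3-4*x+2)`
(`h = 1`, `h(k₁) = 1` CERT), `L_P = ℚ(P, ζ₃) = ℚ[x]/(x^16-4*x^15+10*x^14+4*x^13+8*x^12-44*x^11+48*x^10-60*x^9+171*x^8-80*x^7+176*x^6-260*x^5+292*x^4-244*x^3+190*x^2-96*x+21)` (degree 16; `h = 2`, `Cl ≅ [2]`, CERTIFIED; primes above `3`: `4[[2,1],[6,1],[2,1],[6,1]]`; TOTRAM); octic leaves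
`O₁ = ℚ(P) = x^8-4*x^7+4*x^6-6*x^4+12*x^3+20*x^2-32*x-7` (`h = 1` CERT; layer 1: `h = 3`, `e₁ = 1` GRH), `O₂ = x^8-4*x^7+4*x^6-20*x^5+14*x^4-20*x^3+4*x^2-4*x+1` (`h = 1` CERT; layer 1: `h = 1`, `e₁ = 0` GRH), `O₃ = x^8-6*x^7+18*x^6-46*x^5+90*x^4-114*x^3+106*x^2-66*x+21` (`h = 2` CERT;
layer 1: `h = 2`, `e₁ = 0` GRH); Kuroda check at layer 0: `layer0; #octics>k 3 of 3 octic subfields; v3h(L_P)+2v3h(k) 0; sum v3h(O_i) 0; KURODA-OK; octics certified 1; k cert CERT`; ⟹ `e₀(L_P) = 0 < e₁(L_P) = 1` = `e₁(O₁)`, growing leaf `O_grow = O₁`.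
THIS SEAT's kit j316285 (`ugsurj.gp`) on `O_grow`: `F = O_grow·ℚ(ζ₉)⁺ = ℚ[x]/(x^24-90*x^20-480*x^18+81*x^16+4608*x^14+9426*x^12+3024*x^10-11970*x^8-17056*x^6-9828*x^4-2592*x^2-243)` (degree 24): `h = 3` (`Cl ≅ [3]`, GRH (`bnfcertify` did not finish in the cap)), `s = 3` primes above `3` (`[e,f] = [[6,1],[9,1],[9,1]]`),
all ramified in `F₂/F`; unit norm symbols of rank `2 = s − 1`; prime classes span `Cl(F)/3`: UG-PASS(1,2) (`ord₃ h(O_grow,2) = ord₃ h(O_grow,1)`) ⟹ `e₂(O_grow) = e₁(O_grow) = 1` ⟹ (Kuroda) `e₂(L_P) = e₁(L_P) = 1`. -/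

/-- **(A) AT `(7776f1, 3)` with the `μ`-hypothesis DISCHARGED by FUKUDA Thm. 1 (1) at layers `(1,2)` on `L_P = ℚ(E[3])^{U_P}`** (modulo the named facts
Lim 2017 Thm. 3.5 `hLim` and Fukuda `hF1`): `P` any geometric `3`-torsion point, displayed numerics on `L_P`: Fukuda index `0` (`hram`, exact: kit j296187) and
`e₂(L_P) = e₁(L_P)` (`hord`; evidence: door UG on `O_grow` at `(1,2)`, kit j316285, + Kuroda + Fukuda `(0,1)` on the non-growing leaves, kit j296187 — see the module
docstring). CONDITIONAL; nothing booked; (A)/BSD proved for no curve.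
[cite: Lim2017FineSelmer, §3 Thm. 3.5 and Lemma 3.2 (arXiv:1306.2047 pp. 6–7)] [cite: Fukuda1994, Thm. 1 (1), p. 264] [cite: Cremona2006, Table 1 (Cremona label 7776f1)] -/
theorem conjA_g7776f1_3_lp12
    (hLim : Lim2017.thm35_fineSelmerDual_moduleFinite_of_classicalMuVanishes_of_le_divisionField)
    (hF1 : fukuda1994_thm1_classNumberPExp_const_of_succ_eq)
    {W : WeierstrassCurve ℚ} [W.IsElliptic] (hWeq : W = (⟨0, 0, 0, (-48843), (-4154814)⟩ : WeierstrassCurve ℚ)) (P : W.geomTorsion (3 : ℕ))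
    (hram : ∀ κ : ZpExtension ↥(W.unipotentStabilizerField 3 P) 3, κ.IsCyclotomic → TotallyRamifiedFrom κ 0)
    (hord : ∀ κ : ZpExtension ↥(W.unipotentStabilizerField 3 P) 3, κ.IsCyclotomic →
      classNumberPExp κ (1 + 1) = classNumberPExp κ 1)
    (κ : ZpExtension ℚ 3) (hκ : κ.IsCyclotomic) :
    ∃ (γ : absoluteGaloisGroup ℚ) (Df : W.FineSelmerDualData κ γ),
      Module.Finite ℤ_[3] (RestrictScalars ℤ_[3] (IwasawaAlgebra 3) Df.X) := by
  subst hWeq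
  haveI : Fact (Nat.Prime 3) := ⟨Nat.prime_three⟩
  exact Lim2017.fineSelmerDual_moduleFinite_of_classNumberPExp_succ_eq_unipotentStabilizerField hF1 hLim _ 3 (by decide) 1 P hram hord κ hκ

/-- **RECORD (second road) — U₀ `ord₃ #Ш(E) ≤ ord₃ #Ш_an(E)` for `E = 7776f1` with the `μ`-hypothesis DISCHARGED by FUKUDA Thm. 1 (1) at layers `(1,2)` on `L_P`**: named facts
{A161-fine `hKatoA`, GZK `hGZK`, modularity `hmod`, `hLim`, `hF1`}, Cremona's `r_an = 0` (`hr`), a `3`-torsion point `P` and the displayed numerics `hram` / `hord` of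
`L_P = ℚ(E[3])^{U_P}` (evidence: kits j296187 / j316285 + Kuroda, module docstring; GRH through the degree-24 class groups only). KERNEL: `E` elliptic, minimal,
`ClassO6 E 3`, `E[3]` irreducible. Per row; nothing booked; BSD proved for no curve. [cite: Kato2004Asterisque, Thm. 14.5 (3) (p. 236)]
[cite: Lim2017FineSelmer, §3 Thm. 3.5 and Lemma 3.2 (arXiv:1306.2047 pp. 6–7)] [cite: Fukuda1994, Thm. 1 (1), p. 264] [cite: Cremona2006, Table 1 (Cremona label 7776f1)] -/
theorem missingUpperBoundAt_g7776f1_3_lp12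
    (hKatoA : Kato2004.rankZero_padicValNat_sha_add_padicValNat_tamagawa_le_of_additive_potGood_of_irreducible_of_fineSelmerDual_fg)
    (hGZK : rank_eq_analyticRank_of_analyticRank_le_one) (hmod : hasEntireLFunction_rat)
    (hLim : Lim2017.thm35_fineSelmerDual_moduleFinite_of_classicalMuVanishes_of_le_divisionField)
    (hF1 : fukuda1994_thm1_classNumberPExp_const_of_succ_eq)
    {W : WeierstrassCurve ℚ} [W.IsElliptic] [W.IsGloballyMinimal] (hWeq : W = (⟨0, 0, 0, (-48843), (-4154814)⟩ : WeierstrassCurve ℚ))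
    (hr : W.analyticRank = 0) (P : W.geomTorsion (3 : ℕ))
    (hram : ∀ κ : ZpExtension ↥(W.unipotentStabilizerField 3 P) 3, κ.IsCyclotomic → TotallyRamifiedFrom κ 0)
    (hord : ∀ κ : ZpExtension ↥(W.unipotentStabilizerField 3 P) 3, κ.IsCyclotomic →
      classNumberPExp κ (1 + 1) = classNumberPExp κ 1) :
    MissingUpperBoundAt W 3 := by
  subst hWeq
  haveI : Fact (Nat.Prime 3) := ⟨Nat.prime_three⟩
  exact UnitIndexMuDoors.missingUpperBoundAt_three_of_classNumberPExp_succ_eqAt_unipotentStabilizerField _ hKatoA hGZK hmod hLim hF1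
    hr classO6_g7776f1_3 irr_g7776f1_3 P 1 hram hord

/-! ### `194400cn1` @ `p = 3` — `N = 194400 = 2^5·3^5·5^2`; Cremona: `r_an = 0`; O6 wild at `3`; mod-`3` image `GL₂(𝔽₃)` (9-deficient tower; NO Cartan road); first road: the unit-twist record `missingUpperBoundAt_g194400cn1_3` (k9-c4 g16/g17);
kernel lemmas in `…WildUpperUnitTwistRecordsClassO606` (`classO6`) / `…WildUpperUnitTwistRecordsFlat43` (`irr`, `isElliptic`, `isGloballyMinimal`).  conjA-anchor g9 kit j296187 (`lp16.gp`): `k = ℚ(x(P)) = ℚ[x]/(x^4-2*x^3-4*x+2)`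
(`h = 1`, `h(k₁) = 1` CERT), `L_P = ℚ(P, ζ₃) = ℚ[x]/(x^16-4*x^15+10*x^14+68*x^13-182*x^12-820*x^11+10402*x^10-42364*x^9+89707*x^8-40968*x^7-305298*x^6+910812*x^5-1016604*x^4-280476*x^3+2505528*x^2-3290004*x+1906281)` (degree 16; `h = 4`, `Cl ≅ [2, 2]`, CERTIFIED; primes above `3`: `4[[2,1],[6,1],[2,1],[6,1]]`; TOTRAM); octic leaves
`O₁ = ℚ(P) = x^8+6*x^6-28*x^5-120*x^4+96*x^3+84*x^2+36*x-126` (`h = 2` CERT; layer 1: `h = 6`, `e₁ = 1` GRH), `O₂ = x^8-22*x^6-128*x^5-228*x^4-52*x^3+130*x^2-24*x-91` (`h = 2` CERT; layer 1: `h = 2`, `e₁ = 0` GRH), `O₃ = x^8-4*x^7+16*x^6-34*x^5+55*x^4-58*x^3+22*x^2+2*x+1` (`h = 2` CERT;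
layer 1: `h = 2`, `e₁ = 0` GRH); Kuroda check at layer 0: `layer0; #octics>k 3 of 3 octic subfields; v3h(L_P)+2v3h(k) 0; sum v3h(O_i) 0; KURODA-OK; octics certified 1; k cert CERT`; ⟹ `e₀(L_P) = 0 < e₁(L_P) = 1` = `e₁(O₁)`, growing leaf `O_grow = O₁`.
THIS SEAT's kit j316285 (`ugsurj.gp`) on `O_grow`: `F = O_grow·ℚ(ζ₉)⁺ = ℚ[x]/(x^24-6*x^22-76*x^21-324*x^20+192*x^19-620*x^18+35496*x^17+30366*x^16-113048*x^15+87912*x^14-4287840*x^13-2473168*x^12+44925408*x^11-70098*x^10-166321952*x^9+57170547*x^8+253968480*x^7-93960846*x^6-212713560*x^5+18115974*x^4+124296336*x^3+83065338*x^2-52448472*x-74267631)` (degree 24): `h = 6` (`Cl ≅ [6]`, GRH (`bnfcertify` did not finish in the cap)), `s = 3` primes above `3` (`[e,f] = [[9,1],[9,1],[6,1]]`),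
all ramified in `F₂/F`; unit norm symbols of rank `2 = s − 1`; prime classes span `Cl(F)/3`: UG-PASS(1,2) (`ord₃ h(O_grow,2) = ord₃ h(O_grow,1)`) ⟹ `e₂(O_grow) = e₁(O_grow) = 1` ⟹ (Kuroda) `e₂(L_P) = e₁(L_P) = 1`. -/

/-- **(A) AT `(194400cn1, 3)` with the `μ`-hypothesis DISCHARGED by FUKUDA Thm. 1 (1) at layers `(1,2)` on `L_P = ℚ(E[3])^{U_P}`** (modulo the named facts
Lim 2017 Thm. 3.5 `hLim` and Fukuda `hF1`): `P` any geometric `3`-torsion point, displayed numerics on `L_P`: Fukuda index `0` (`hram`, exact: kit j296187) and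
`e₂(L_P) = e₁(L_P)` (`hord`; evidence: door UG on `O_grow` at `(1,2)`, kit j316285, + Kuroda + Fukuda `(0,1)` on the non-growing leaves, kit j296187 — see the module
docstring). CONDITIONAL; nothing booked; (A)/BSD proved for no curve.
[cite: Lim2017FineSelmer, §3 Thm. 3.5 and Lemma 3.2 (arXiv:1306.2047 pp. 6–7)] [cite: Fukuda1994, Thm. 1 (1), p. 264] [cite: Cremona2006, Table 1 (Cremona label 194400cn1)] -/
theorem conjA_g194400cn1_3_lp12
    (hLim : Lim2017.thm35_fineSelmerDual_moduleFinite_of_classicalMuVanishes_of_le_divisionField)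
    (hF1 : fukuda1994_thm1_classNumberPExp_const_of_succ_eq)
    {W : WeierstrassCurve ℚ} [W.IsElliptic] (hWeq : W = (⟨0, 0, 0, (-1221075), 519351750⟩ : WeierstrassCurve ℚ)) (P : W.geomTorsion (3 : ℕ))
    (hram : ∀ κ : ZpExtension ↥(W.unipotentStabilizerField 3 P) 3, κ.IsCyclotomic → TotallyRamifiedFrom κ 0)
    (hord : ∀ κ : ZpExtension ↥(W.unipotentStabilizerField 3 P) 3, κ.IsCyclotomic →
      classNumberPExp κ (1 + 1) = classNumberPExp κ 1)
    (κ : ZpExtension ℚ 3) (hκ : κ.IsCyclotomic) :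
    ∃ (γ : absoluteGaloisGroup ℚ) (Df : W.FineSelmerDualData κ γ),
      Module.Finite ℤ_[3] (RestrictScalars ℤ_[3] (IwasawaAlgebra 3) Df.X) := by
  subst hWeq
  haveI : Fact (Nat.Prime 3) := ⟨Nat.prime_three⟩
  exact Lim2017.fineSelmerDual_moduleFinite_of_classNumberPExp_succ_eq_unipotentStabilizerField hF1 hLim _ 3 (by decide) 1 P hram hord κ hκ

/-- **RECORD (second road) — U₀ `ord₃ #Ш(E) ≤ ord₃ #Ш_an(E)` for `E = 194400cn1` with the `μ`-hypothesis DISCHARGED by FUKUDA Thm. 1 (1) at layers `(1,2)` on `L_P`**: named facts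
{A161-fine `hKatoA`, GZK `hGZK`, modularity `hmod`, `hLim`, `hF1`}, Cremona's `r_an = 0` (`hr`), a `3`-torsion point `P` and the displayed numerics `hram` / `hord` of
`L_P = ℚ(E[3])^{U_P}` (evidence: kits j296187 / j316285 + Kuroda, module docstring; GRH through the degree-24 class groups only). KERNEL: `E` elliptic, minimal,
`ClassO6 E 3`, `E[3]` irreducible. Per row; nothing booked; BSD proved for no curve. [cite: Kato2004Asterisque, Thm. 14.5 (3) (p. 236)]
[cite: Lim2017FineSelmer, §3 Thm. 3.5 and Lemma 3.2 (arXiv:1306.2047 pp. 6–7)] [cite: Fukuda1994, Thm. 1 (1), p. 264] [cite: Cremona2006, Table 1 (Cremona label 194400cn1)] -/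
theorem missingUpperBoundAt_g194400cn1_3_lp12
    (hKatoA : Kato2004.rankZero_padicValNat_sha_add_padicValNat_tamagawa_le_of_additive_potGood_of_irreducible_of_fineSelmerDual_fg)
    (hGZK : rank_eq_analyticRank_of_analyticRank_le_one) (hmod : hasEntireLFunction_rat)
    (hLim : Lim2017.thm35_fineSelmerDual_moduleFinite_of_classicalMuVanishes_of_le_divisionField)
    (hF1 : fukuda1994_thm1_classNumberPExp_const_of_succ_eq)
    {W : WeierstrassCurve ℚ} [W.IsElliptic] [W.IsGloballyMinimal] (hWeq : W = (⟨0, 0, 0, (-1221075), 519351750⟩ : WeierstrassCurve ℚ))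
    (hr : W.analyticRank = 0) (P : W.geomTorsion (3 : ℕ))
    (hram : ∀ κ : ZpExtension ↥(W.unipotentStabilizerField 3 P) 3, κ.IsCyclotomic → TotallyRamifiedFrom κ 0)
    (hord : ∀ κ : ZpExtension ↥(W.unipotentStabilizerField 3 P) 3, κ.IsCyclotomic →
      classNumberPExp κ (1 + 1) = classNumberPExp κ 1) :
    MissingUpperBoundAt W 3 := by
  subst hWeq
  haveI : Fact (Nat.Prime 3) := ⟨Nat.prime_three⟩
  exact UnitIndexMuDoors.missingUpperBoundAt_three_of_classNumberPExp_succ_eqAt_unipotentStabilizerField _ hKatoA hGZK hmod hLim hF1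
    hr classO6_g194400cn1_3 irr_g194400cn1_3 P 1 hram hord

/-! ### `388800hd1` @ `p = 3` — `N = 388800 = 2^6·3^5·5^2`; Cremona: `r_an = 0`; O6 wild at `3`; mod-`3` image `GL₂(𝔽₃)` (9-deficient tower; NO Cartan road); first road: the unit-twist record `missingUpperBoundAt_g388800hd1_3` (k9-c4 g16/g17);
kernel lemmas in `…WildUpperUnitTwistRecordsClassO617` (`classO6`) / `…WildUpperUnitTwistRecordsFlat46` (`irr`, `isElliptic`, `isGloballyMinimal`).  conjA-anchor g9 kit j296187 (`lp16.gp`): `k = ℚ(x(P)) = ℚ[x]/(x^4-6*x^2-2*x+6)`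
(`h = 1`, `h(k₁) = 1` CERT), `L_P = ℚ(P, ζ₃) = ℚ[x]/(x^16+150*x^12+2500*x^10+24375*x^8+187500*x^6+1281250*x^4+2343750*x^2+3515625)` (degree 16; `h = 2`, `Cl ≅ [2]`, CERTIFIED; primes above `3`: `4[[2,1],[2,1],[6,1],[6,1]]`; TOTRAM); octic leaves
`O₁ = ℚ(P) = x^8-150*x^4+1250*x^2-1875` (`h = 2` CERT; layer 1: `h = 6`, `e₁ = 1` GRH), `O₂ = x^8-450*x^4+5250*x^2-16875` (`h = 2` CERT; layer 1: `h = 2`, `e₁ = 0` GRH), `O₃ = x^8-4*x^7+4*x^6-2*x^5+5*x^4-2*x^3+4*x^2-4*x+1` (`h = 1` CERT;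
layer 1: `h = 1`, `e₁ = 0` GRH); Kuroda check at layer 0: `layer0; #octics>k 3 of 3 octic subfields; v3h(L_P)+2v3h(k) 0; sum v3h(O_i) 0; KURODA-OK; octics certified 1; k cert CERT`; ⟹ `e₀(L_P) = 0 < e₁(L_P) = 1` = `e₁(O₁)`, growing leaf `O_grow = O₁`.
THIS SEAT's kit j316285 (`ugsurj.gp`) on `O_grow`: `F = O_grow·ℚ(ζ₉)⁺ = ℚ[x]/(x^24-12*x^23+60*x^22-148*x^21-66*x^20+2868*x^19-15170*x^18+51876*x^17-86598*x^16-445552*x^15+3153144*x^14-7735992*x^13-2352542*x^12+109477128*x^11-288314736*x^10-507186424*x^9+2573655831*x^8+1007810316*x^7-10602860400*x^6-2263428432*x^5+21205922850*x^4+6872044020*x^3-16060899690*x^2-3742204032*x+4160464941)` (degree 24): `h = 6` (`Cl ≅ [6]`, GRH (`bnfcertify` did not finish in the cap)), `s = 3` primes above `3` (`[e,f] = [[9,1],[9,1],[6,1]]`),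
all ramified in `F₂/F`; unit norm symbols of rank `2 = s − 1`; prime classes span `Cl(F)/3`: UG-PASS(1,2) (`ord₃ h(O_grow,2) = ord₃ h(O_grow,1)`) ⟹ `e₂(O_grow) = e₁(O_grow) = 1` ⟹ (Kuroda) `e₂(L_P) = e₁(L_P) = 1`. -/

/-- **(A) AT `(388800hd1, 3)` with the `μ`-hypothesis DISCHARGED by FUKUDA Thm. 1 (1) at layers `(1,2)` on `L_P = ℚ(E[3])^{U_P}`** (modulo the named facts
Lim 2017 Thm. 3.5 `hLim` and Fukuda `hF1`): `P` any geometric `3`-torsion point, displayed numerics on `L_P`: Fukuda index `0` (`hram`, exact: kit j296187) and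
`e₂(L_P) = e₁(L_P)` (`hord`; evidence: door UG on `O_grow` at `(1,2)`, kit j316285, + Kuroda + Fukuda `(0,1)` on the non-growing leaves, kit j296187 — see the module
docstring). CONDITIONAL; nothing booked; (A)/BSD proved for no curve.
[cite: Lim2017FineSelmer, §3 Thm. 3.5 and Lemma 3.2 (arXiv:1306.2047 pp. 6–7)] [cite: Fukuda1994, Thm. 1 (1), p. 264] [cite: Cremona2006, Table 1 (Cremona label 388800hd1)] -/
theorem conjA_g388800hd1_3_lp12
    (hLim : Lim2017.thm35_fineSelmerDual_moduleFinite_of_classicalMuVanishes_of_le_divisionField)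
    (hF1 : fukuda1994_thm1_classNumberPExp_const_of_succ_eq)
    {W : WeierstrassCurve ℚ} [W.IsElliptic] (hWeq : W = (⟨0, 0, 0, (-2700), 42000⟩ : WeierstrassCurve ℚ)) (P : W.geomTorsion (3 : ℕ))
    (hram : ∀ κ : ZpExtension ↥(W.unipotentStabilizerField 3 P) 3, κ.IsCyclotomic → TotallyRamifiedFrom κ 0)
    (hord : ∀ κ : ZpExtension ↥(W.unipotentStabilizerField 3 P) 3, κ.IsCyclotomic →
      classNumberPExp κ (1 + 1) = classNumberPExp κ 1)
    (κ : ZpExtension ℚ 3) (hκ : κ.IsCyclotomic) :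
    ∃ (γ : absoluteGaloisGroup ℚ) (Df : W.FineSelmerDualData κ γ),
      Module.Finite ℤ_[3] (RestrictScalars ℤ_[3] (IwasawaAlgebra 3) Df.X) := by
  subst hWeq
  haveI : Fact (Nat.Prime 3) := ⟨Nat.prime_three⟩
  exact Lim2017.fineSelmerDual_moduleFinite_of_classNumberPExp_succ_eq_unipotentStabilizerField hF1 hLim _ 3 (by decide) 1 P hram hord κ hκ

/-- **RECORD (second road) — U₀ `ord₃ #Ш(E) ≤ ord₃ #Ш_an(E)` for `E = 388800hd1` with the `μ`-hypothesis DISCHARGED by FUKUDA Thm. 1 (1) at layers `(1,2)` on `L_P`**: named facts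
{A161-fine `hKatoA`, GZK `hGZK`, modularity `hmod`, `hLim`, `hF1`}, Cremona's `r_an = 0` (`hr`), a `3`-torsion point `P` and the displayed numerics `hram` / `hord` of
`L_P = ℚ(E[3])^{U_P}` (evidence: kits j296187 / j316285 + Kuroda, module docstring; GRH through the degree-24 class groups only). KERNEL: `E` elliptic, minimal,
`ClassO6 E 3`, `E[3]` irreducible. Per row; nothing booked; BSD proved for no curve. [cite: Kato2004Asterisque, Thm. 14.5 (3) (p. 236)]
[cite: Lim2017FineSelmer, §3 Thm. 3.5 and Lemma 3.2 (arXiv:1306.2047 pp. 6–7)] [cite: Fukuda1994, Thm. 1 (1), p. 264] [cite: Cremona2006, Table 1 (Cremona label 388800hd1)] -/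
theorem missingUpperBoundAt_g388800hd1_3_lp12
    (hKatoA : Kato2004.rankZero_padicValNat_sha_add_padicValNat_tamagawa_le_of_additive_potGood_of_irreducible_of_fineSelmerDual_fg)
    (hGZK : rank_eq_analyticRank_of_analyticRank_le_one) (hmod : hasEntireLFunction_rat)
    (hLim : Lim2017.thm35_fineSelmerDual_moduleFinite_of_classicalMuVanishes_of_le_divisionField)
    (hF1 : fukuda1994_thm1_classNumberPExp_const_of_succ_eq)
    {W : WeierstrassCurve ℚ} [W.IsElliptic] [W.IsGloballyMinimal] (hWeq : W = (⟨0, 0, 0, (-2700), 42000⟩ : WeierstrassCurve ℚ))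
    (hr : W.analyticRank = 0) (P : W.geomTorsion (3 : ℕ))
    (hram : ∀ κ : ZpExtension ↥(W.unipotentStabilizerField 3 P) 3, κ.IsCyclotomic → TotallyRamifiedFrom κ 0)
    (hord : ∀ κ : ZpExtension ↥(W.unipotentStabilizerField 3 P) 3, κ.IsCyclotomic →
      classNumberPExp κ (1 + 1) = classNumberPExp κ 1) :
    MissingUpperBoundAt W 3 := by
  subst hWeq
  haveI : Fact (Nat.Prime 3) := ⟨Nat.prime_three⟩
  exact UnitIndexMuDoors.missingUpperBoundAt_three_of_classNumberPExp_succ_eqAt_unipotentStabilizerField _ hKatoA hGZK hmod hLim hF1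
    hr classO6_g388800hd1_3 irr_g388800hd1_3 P 1 hram hord

/-! ### `388800ij1` @ `p = 3` — `N = 388800 = 2^6·3^5·5^2`; Cremona: `r_an = 0`; O6 wild at `3`; mod-`3` image `GL₂(𝔽₃)` (9-deficient tower; NO Cartan road); first road: k9-c4 g21 residue-twin record `conjA_g388800ij1_3_lp12` (`--supports 19386`) + unit-twist records `_nf/_tam`;
kernel lemmas in `…WildUpperUnitTwistRecordsClassO618` (`classO6`) / `…WildUpperUnitTwistRecordsSharpP25` (`irr`, `isElliptic`, `isGloballyMinimal`).  conjA-anchor g9 kit j296187 (`lp16.gp`): `k = ℚ(x(P)) = ℚ[x]/(x^4-6*x^2-7*x-3)`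
(`h = 1`, `h(k₁) = 1` CERT), `L_P = ℚ(P, ζ₃) = ℚ[x]/(x^16+24*x^12+112*x^10+624*x^8+1344*x^6+1984*x^4+2688*x^2+2304)` (degree 16; `h = 2`, `Cl ≅ [2]`, CERTIFIED; primes above `3`: `4[[6,1],[6,1],[2,1],[2,1]]`; TOTRAM); octic leaves
`O₁ = ℚ(P) = x^8-2*x^7+x^6+56*x^5-130*x^4+146*x^3-114*x^2+48*x-15` (`h = 2` CERT; layer 1: `h = 6`, `e₁ = 1` GRH), `O₂ = x^8+20*x^6-36*x^4+48*x^2-48` (`h = 2` CERT; layer 1: `h = 2`, `e₁ = 0` GRH), `O₃ = x^8-x^7+x^6-8*x^5+5*x^4-2*x^3+16*x^2-4*x+1` (`h = 2` CERT;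
layer 1: `h = 2`, `e₁ = 0` GRH); Kuroda check at layer 0: `layer0; #octics>k 3 of 3 octic subfields; v3h(L_P)+2v3h(k) 0; sum v3h(O_i) 0; KURODA-OK; octics certified 1; k cert CERT`; ⟹ `e₀(L_P) = 0 < e₁(L_P) = 1` = `e₁(O₁)`, growing leaf `O_grow = O₁`.
THIS SEAT's kit j316285 (`ugsurj.gp`) on `O_grow`: `F = O_grow·ℚ(ζ₉)⁺ = ℚ[x]/(x^24+24*x^22-1248*x^18+3456*x^16+41472*x^14-47232*x^12-176256*x^10+55296*x^8+184320*x^6+110592*x^4-110592)` (degree 24): `h = 6` (`Cl ≅ [6]`, GRH (`bnfcertify` did not finish in the cap)), `s = 3` primes above `3` (`[e,f] = [[9,1],[9,1],[6,1]]`),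
all ramified in `F₂/F`; unit norm symbols of rank `2 = s − 1`; prime classes span `Cl(F)/3`: UG-PASS(1,2) (`ord₃ h(O_grow,2) = ord₃ h(O_grow,1)`) ⟹ `e₂(O_grow) = e₁(O_grow) = 1` ⟹ (Kuroda) `e₂(L_P) = e₁(L_P) = 1`. -/

-- (A) at (388800ij1, 3) in this `_lp12` form is ALREADY in the tree: `conjA_g388800ij1_3_lp12` (k9-c4 g21, `…WildFineAUnitIndexRow388800ij1`, p646955,
-- `--supports 19386`; same field `L_P` as 388800ho1, numerics conjA j311095 = this seat's j316285 regression row) — not re-declared here.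

/-- **RECORD (second road) — U₀ `ord₃ #Ш(E) ≤ ord₃ #Ш_an(E)` for `E = 388800ij1` with the `μ`-hypothesis DISCHARGED by FUKUDA Thm. 1 (1) at layers `(1,2)` on `L_P`**: named facts
{A161-fine `hKatoA`, GZK `hGZK`, modularity `hmod`, `hLim`, `hF1`}, Cremona's `r_an = 0` (`hr`), a `3`-torsion point `P` and the displayed numerics `hram` / `hord` of
`L_P = ℚ(E[3])^{U_P}` (evidence: kits j296187 / j316285 + Kuroda, module docstring; GRH through the degree-24 class groups only). KERNEL: `E` elliptic, minimal,
`ClassO6 E 3`, `E[3]` irreducible. Per row; nothing booked; BSD proved for no curve. [cite: Kato2004Asterisque, Thm. 14.5 (3) (p. 236)]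
[cite: Lim2017FineSelmer, §3 Thm. 3.5 and Lemma 3.2 (arXiv:1306.2047 pp. 6–7)] [cite: Fukuda1994, Thm. 1 (1), p. 264] [cite: Cremona2006, Table 1 (Cremona label 388800ij1)] -/
theorem missingUpperBoundAt_g388800ij1_3_lp12
    (hKatoA : Kato2004.rankZero_padicValNat_sha_add_padicValNat_tamagawa_le_of_additive_potGood_of_irreducible_of_fineSelmerDual_fg)
    (hGZK : rank_eq_analyticRank_of_analyticRank_le_one) (hmod : hasEntireLFunction_rat)
    (hLim : Lim2017.thm35_fineSelmerDual_moduleFinite_of_classicalMuVanishes_of_le_divisionField)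
    (hF1 : fukuda1994_thm1_classNumberPExp_const_of_succ_eq)
    {W : WeierstrassCurve ℚ} [W.IsElliptic] [W.IsGloballyMinimal] (hWeq : W = (⟨0, 0, 0, (-121500), 16301250⟩ : WeierstrassCurve ℚ))
    (hr : W.analyticRank = 0) (P : W.geomTorsion (3 : ℕ))
    (hram : ∀ κ : ZpExtension ↥(W.unipotentStabilizerField 3 P) 3, κ.IsCyclotomic → TotallyRamifiedFrom κ 0)
    (hord : ∀ κ : ZpExtension ↥(W.unipotentStabilizerField 3 P) 3, κ.IsCyclotomic →
      classNumberPExp κ (1 + 1) = classNumberPExp κ 1) :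
    MissingUpperBoundAt W 3 := by
  subst hWeq
  haveI : Fact (Nat.Prime 3) := ⟨Nat.prime_three⟩
  exact UnitIndexMuDoors.missingUpperBoundAt_three_of_classNumberPExp_succ_eqAt_unipotentStabilizerField _ hKatoA hGZK hmod hLim hF1
    hr classO6_g388800ij1_3 irr_g388800ij1_3 P 1 hram hord

/-! ### `470448dq1` @ `p = 3` — `N = 470448 = 2^4·3^5·11^2`; Cremona: `r_an = 0`; O6 wild at `3`; mod-`3` image `GL₂(𝔽₃)` (9-deficient tower; NO Cartan road); first road: the unit-twist record `missingUpperBoundAt_g470448dq1_3` (k9-c4 g16/g17);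
kernel lemmas in `…WildUpperUnitTwistRecordsClassO621` (`classO6`) / `…WildUpperUnitTwistRecordsFlat49` (`irr`, `isElliptic`, `isGloballyMinimal`).  conjA-anchor g9 kit j296187 (`lp16.gp`): `k = ℚ(x(P)) = ℚ[x]/(x^4-6*x^2-2*x+6)`
(`h = 1`, `h(k₁) = 1` CERT), `L_P = ℚ(P, ζ₃) = ℚ[x]/(x^16-12*x^15+72*x^14-352*x^13+1716*x^12-5604*x^11+2008*x^10+55116*x^9-170340*x^8+82380*x^7+384480*x^6-382500*x^5+142704*x^4-2888460*x^3+6330420*x^2-11468952*x+18636399)` (degree 16; `h = 2`, `Cl ≅ [2]`, CERTIFIED; primes above `3`: `4[[6,1],[2,1],[6,1],[2,1]]`; TOTRAM); octic leaves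
`O₁ = ℚ(P) = x^8-22*x^6-114*x^5+1152*x^4-3036*x^3+3216*x^2-522*x-1821` (`h = 1` CERT; layer 1: `h = 1`, `e₁ = 0` GRH), `O₂ = x^8-8*x^7+34*x^6-54*x^5-744*x^4+6144*x^3-19852*x^2+29798*x-17173` (`h = 1` CERT; layer 1: `h = 3`, `e₁ = 1` GRH), `O₃ = x^8-4*x^7+4*x^6-2*x^5+5*x^4-2*x^3+4*x^2-4*x+1` (`h = 1` CERT;
layer 1: `h = 1`, `e₁ = 0` GRH); Kuroda check at layer 0: `layer0; #octics>k 3 of 3 octic subfields; v3h(L_P)+2v3h(k) 0; sum v3h(O_i) 0; KURODA-OK; octics certified 1; k cert CERT`; ⟹ `e₀(L_P) = 0 < e₁(L_P) = 1` = `e₁(O₂)`, growing leaf `O_grow = O₂`.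
THIS SEAT's kit j316285 (`ugsurj.gp`) on `O_grow`: `F = O_grow·ℚ(ζ₉)⁺ = ℚ[x]/(x^24-18*x^22-102*x^21-1062*x^20-3600*x^19-1344*x^18+47934*x^17+505413*x^16+2984080*x^15+11063358*x^14+27802872*x^13+17628288*x^12-282471984*x^11-1962082584*x^10-8227968282*x^9-25786650330*x^8-64573138008*x^7-131907526512*x^6-223547932188*x^5-310227608340*x^4-348858418428*x^3-303352439526*x^2-196188218532*x-69457250763)` (degree 24): `h = 3` (`Cl ≅ [3]`, GRH (`bnfcertify` did not finish in the cap)), `s = 3` primes above `3` (`[e,f] = [[6,1],[9,1],[9,1]]`),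
all ramified in `F₂/F`; unit norm symbols of rank `2 = s − 1`; prime classes span `Cl(F)/3`: UG-PASS(1,2) (`ord₃ h(O_grow,2) = ord₃ h(O_grow,1)`) ⟹ `e₂(O_grow) = e₁(O_grow) = 1` ⟹ (Kuroda) `e₂(L_P) = e₁(L_P) = 1`. -/

/-- **(A) AT `(470448dq1, 3)` with the `μ`-hypothesis DISCHARGED by FUKUDA Thm. 1 (1) at layers `(1,2)` on `L_P = ℚ(E[3])^{U_P}`** (modulo the named facts
Lim 2017 Thm. 3.5 `hLim` and Fukuda `hF1`): `P` any geometric `3`-torsion point, displayed numerics on `L_P`: Fukuda index `0` (`hram`, exact: kit j296187) and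
`e₂(L_P) = e₁(L_P)` (`hord`; evidence: door UG on `O_grow` at `(1,2)`, kit j316285, + Kuroda + Fukuda `(0,1)` on the non-growing leaves, kit j296187 — see the module
docstring). CONDITIONAL; nothing booked; (A)/BSD proved for no curve.
[cite: Lim2017FineSelmer, §3 Thm. 3.5 and Lemma 3.2 (arXiv:1306.2047 pp. 6–7)] [cite: Fukuda1994, Thm. 1 (1), p. 264] [cite: Cremona2006, Table 1 (Cremona label 470448dq1)] -/
theorem conjA_g470448dq1_3_lp12
    (hLim : Lim2017.thm35_fineSelmerDual_moduleFinite_of_classicalMuVanishes_of_le_divisionField)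
    (hF1 : fukuda1994_thm1_classNumberPExp_const_of_succ_eq)
    {W : WeierstrassCurve ℚ} [W.IsElliptic] (hWeq : W = (⟨0, 0, 0, (-3267), (-55902)⟩ : WeierstrassCurve ℚ)) (P : W.geomTorsion (3 : ℕ))
    (hram : ∀ κ : ZpExtension ↥(W.unipotentStabilizerField 3 P) 3, κ.IsCyclotomic → TotallyRamifiedFrom κ 0)
    (hord : ∀ κ : ZpExtension ↥(W.unipotentStabilizerField 3 P) 3, κ.IsCyclotomic →
      classNumberPExp κ (1 + 1) = classNumberPExp κ 1)
    (κ : ZpExtension ℚ 3) (hκ : κ.IsCyclotomic) :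
    ∃ (γ : absoluteGaloisGroup ℚ) (Df : W.FineSelmerDualData κ γ),
      Module.Finite ℤ_[3] (RestrictScalars ℤ_[3] (IwasawaAlgebra 3) Df.X) := by
  subst hWeq
  haveI : Fact (Nat.Prime 3) := ⟨Nat.prime_three⟩
  exact Lim2017.fineSelmerDual_moduleFinite_of_classNumberPExp_succ_eq_unipotentStabilizerField hF1 hLim _ 3 (by decide) 1 P hram hord κ hκ

/-- **RECORD (second road) — U₀ `ord₃ #Ш(E) ≤ ord₃ #Ш_an(E)` for `E = 470448dq1` with the `μ`-hypothesis DISCHARGED by FUKUDA Thm. 1 (1) at layers `(1,2)` on `L_P`**: named facts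
{A161-fine `hKatoA`, GZK `hGZK`, modularity `hmod`, `hLim`, `hF1`}, Cremona's `r_an = 0` (`hr`), a `3`-torsion point `P` and the displayed numerics `hram` / `hord` of
`L_P = ℚ(E[3])^{U_P}` (evidence: kits j296187 / j316285 + Kuroda, module docstring; GRH through the degree-24 class groups only). KERNEL: `E` elliptic, minimal,
`ClassO6 E 3`, `E[3]` irreducible. Per row; nothing booked; BSD proved for no curve. [cite: Kato2004Asterisque, Thm. 14.5 (3) (p. 236)]
[cite: Lim2017FineSelmer, §3 Thm. 3.5 and Lemma 3.2 (arXiv:1306.2047 pp. 6–7)] [cite: Fukuda1994, Thm. 1 (1), p. 264] [cite: Cremona2006, Table 1 (Cremona label 470448dq1)] -/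
theorem missingUpperBoundAt_g470448dq1_3_lp12
    (hKatoA : Kato2004.rankZero_padicValNat_sha_add_padicValNat_tamagawa_le_of_additive_potGood_of_irreducible_of_fineSelmerDual_fg)
    (hGZK : rank_eq_analyticRank_of_analyticRank_le_one) (hmod : hasEntireLFunction_rat)
    (hLim : Lim2017.thm35_fineSelmerDual_moduleFinite_of_classicalMuVanishes_of_le_divisionField)
    (hF1 : fukuda1994_thm1_classNumberPExp_const_of_succ_eq)
    {W : WeierstrassCurve ℚ} [W.IsElliptic] [W.IsGloballyMinimal] (hWeq : W = (⟨0, 0, 0, (-3267), (-55902)⟩ : WeierstrassCurve ℚ))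
    (hr : W.analyticRank = 0) (P : W.geomTorsion (3 : ℕ))
    (hram : ∀ κ : ZpExtension ↥(W.unipotentStabilizerField 3 P) 3, κ.IsCyclotomic → TotallyRamifiedFrom κ 0)
    (hord : ∀ κ : ZpExtension ↥(W.unipotentStabilizerField 3 P) 3, κ.IsCyclotomic →
      classNumberPExp κ (1 + 1) = classNumberPExp κ 1) :
    MissingUpperBoundAt W 3 := by
  subst hWeq
  haveI : Fact (Nat.Prime 3) := ⟨Nat.prime_three⟩
  exact UnitIndexMuDoors.missingUpperBoundAt_three_of_classNumberPExp_succ_eqAt_unipotentStabilizerField _ hKatoA hGZK hmod hLim hF1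
    hr classO6_g470448dq1_3 irr_g470448dq1_3 P 1 hram hord

end Summit.BirchSwinnertonDyer.BirchSwinnertonDyer.Theorems.WildUpperUnitTwistRecords

end
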